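import Literature.Geometry.Riemannian.HamiltonPCOPinchingFive
import HarnessLib

/-!
# Hamilton 1986, Thm. 7.1 assembled: the pinching set of `{M > 0}` and its preservation along the Ricci flow
(topic `Geometry/Riemannian`)

The last brick of the ODE layer of
`Literature.Geometry.Riemannian.hamilton_positiveCurvatureOperator_classification_four`
(`HamiltonPCOClassification.lean`; see the table in `HamiltonPCOClassificationProofs.lean`). With
the five groups of inequalities preserved (`HamiltonPCOPinchingOne/Two/Three/Four/Five.lean`:
`Z = pcoPinchingFive m G H J δ K ε L θ` is forward invariant under Hamilton's ODE `M' = M² + M#`,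
closed, convex and `B ↦ -B`-symmetric), this file PROVES the two remaining clauses of
**Hamilton 1986, Thm. 7.1** (J. Differential Geom. 24, p. 170) and draws the consequence for the
Ricci flow, which is the input of the convergence criterion 5.2 (p. 164):

* `exists_pinching_constants`, `mem_pcoPinchingFive_of_bounds` — "Moreover every compact subset
  of `U = {M > 0}` lies in some such pinching set `Z`" (p. 170: "Given any compact subset of `U`,
  we can make the large constants large enough to contain it, since there will be a lower bound
  on `a₁`, `c₁`, and `a - 2b + c`"): for every `m > 0` and bound `R₀` there are admissible
  constants (in the order of the theorem: `G`; `H`; `δ`; `J`; `ε` — with the auxiliary `η` of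
  Cor. 7.5 —; `K`; `θ`; `L`) such that every symmetric block triple with `tr A = tr C`, `M ≥ m`
  and entries bounded by `R₀` lies in `Z`;
* `pcoPinchingFive_pinching` — the pinching estimate on `Z` in eigenvalue form (Def. 5.1 (4),
  `|M̊| ≤ C|M|^{1-δ}`, via `a₃ - a₁ ≤ L a₁^{1-θ}`, `c₃ - c₁ ≤ L c₁^{1-θ}`, `b₃^{2+ε} ≤ K a₁ c₁`,
  `a = c`);
* `ricciFlow_mem_pcoPinchingFive_of_maximumPrinciple` — along a Ricci flow of Riemannian metrics
  on a closed 4-manifold whose initial blocks lie in `Z` in every orthonormal frame, the blocks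
  stay in `Z` (the maximum principle for systems = the named fact
  `hamilton_maximumPrinciple_curvatureODE`, Hamilton §4, Thm. 4.3, applied to `Z`; 5.2, p. 164:
  "we can find a pinching set `Z` … such that at time `t = 0` the curvature operator `M` lies in
  `X = P ×_G Z`. Then it will remain in `X` by the argument in §4");
* `ricciFlow_pinchingSet_of_hasPositiveCurvatureOperatorWith` — **for an initial metric of positive
  curvature operator there are `m > 0` and admissible constants with the blocks of `g(t)` in `Z`
  in every orthonormal frame for all `t`** (compactness at `t = 0`: `exists_pos_operatorGE_blocks`
  and `exists_bound_blocks`).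

Not here (the PDE layer, absent from the tree): Uhlenbeck's trick and the evolution of `M`
(inside the named fact), and 5.2 itself (the pinching estimate implies convergence modulo
scaling, Hamilton 1982, §§10–17).

## References

* R. S. Hamilton, *Four-manifolds with positive curvature operator*, J. Differential Geom. 24
  (1986) 153–179: §4, Thm. 4.3 (p. 162); §5, Def. 5.1, 5.2 (pp. 163–164); §7, Thm. 7.1
  (pp. 170–174). [Hamilton1986]
-/

noncomputable section

open Set Real Filter Function
open scoped Matrix BigOperators Topology Manifold ContDiff

namespace Literature.Geometry.Riemannian

namespace HamiltonODE

/-! ### Every bounded part of `{M ≥ m}` lies in some pinching set -/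

/-- **Admissible constants** for the pinching set `Z = pcoPinchingFive m G H J δ K ε L θ` containing
the block triples with `a₁, c₁ ≥ m`, `a - 2b + c ≥ 6m` and entries bounded by `R₀`: the eighteen
hypotheses of `isInvariant_pcoPinchingFive` together with the six initial bounds. Choice:
`G = 4R₀²/m² + 1`, `H = G + 1 + R₀/m`, `δ = 1/(8H + 4GH + 1)`, `J = (4R₀² + 1)^{1+δ/2}/(m²(6m)^δ)`,
`η = min(½, (16·8^δ J)^{-1/δ})`, `ε = min(δη/12, η²/144)`, `K = (4R₀² + 1)^{1+ε/2}/m²`,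
`θ = 2ε/(2 + ε)`, `L = 2K^{1-θ/2} + R₀/m^{1-θ}` ("we choose successively constants …",
Thm. 7.1, p. 170). [cite: Hamilton1986, §7, Thm. 7.1 (p. 170)] -/
theorem exists_pinching_constants {m R₀ : ℝ} (hm : 0 < m) (hR₀ : 0 ≤ R₀) :
    ∃ G H δ J η ε K θ L : ℝ,
      (0 < G ∧ G + 1 ≤ H ∧ 0 < δ ∧ δ ≤ 1 ∧ 8 * H * δ ≤ 1 ∧ 4 * G * H * δ ^ 2 ≤ 1 ∧ 0 < J ∧
        0 < η ∧ η ≤ 1 / 2 ∧ 16 * 8 ^ δ * J * η ^ δ ≤ 1 ∧ 0 < ε ∧ 12 * ε ≤ δ * η ∧ 144 * ε ≤ η ^ 2 ∧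
        0 < K ∧ θ * (2 + ε) = 2 * ε ∧ θ ≤ 1 ∧ 6 * H * θ ≤ 1 ∧ 2 * K ^ (1 - θ / 2) ≤ L) ∧
      (4 * R₀ ^ 2 ≤ G * m * m) ∧ (R₀ ≤ H * m) ∧
      ((4 * R₀ ^ 2 + 1) ^ (1 + δ / 2) ≤ J * m * m * (6 * m) ^ δ) ∧
      ((4 * R₀ ^ 2 + 1) ^ (1 + ε / 2) ≤ K * m * m) ∧ (R₀ ≤ L * m ^ (1 - θ)) ∧ 0 ≤ θ := by
  -- `G`, `H`
  obtain ⟨G, hG⟩ : ∃ G : ℝ, G = 4 * R₀ ^ 2 / (m * m) + 1 := ⟨_, rfl⟩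
  have hG0 : 0 < G := by rw [hG]; positivity
  have hGm : 4 * R₀ ^ 2 ≤ G * m * m := by
    rw [hG, add_mul, add_mul, mul_assoc (4 * R₀ ^ 2 / (m * m)), div_mul_cancel₀ _ (by positivity : m * m ≠ 0)]
    nlinarith [mul_pos hm hm]
  obtain ⟨H, hH⟩ : ∃ H : ℝ, H = G + 1 + R₀ / m := ⟨_, rfl⟩
  have hGH : G + 1 ≤ H := by rw [hH]; linarith [div_nonneg hR₀ hm.le]
  have hH1 : 1 ≤ H := by linarith
  have hH0 : 0 < H := by linarith
  have hHm : R₀ ≤ H * m := by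
    rw [hH, add_mul, div_mul_cancel₀ _ hm.ne']
    nlinarith
  -- `δ`
  obtain ⟨δ, hδ⟩ : ∃ δ : ℝ, δ = 1 / (8 * H + 4 * G * H + 1) := ⟨_, rfl⟩
  have hden : 0 < 8 * H + 4 * G * H + 1 := by positivity
  have hδ0 : 0 < δ := by rw [hδ]; positivity
  have hδ1 : δ ≤ 1 := by
    rw [hδ, div_le_one hden]; nlinarith [mul_pos hG0 hH0]
  have hδden : δ * (8 * H + 4 * G * H + 1) = 1 := by rw [hδ, div_mul_cancel₀ _ hden.ne']
  have h8 : 8 * H * δ ≤ 1 := by nlinarith [mul_pos hG0 hH0]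
  have h4' : 4 * G * H * δ ≤ 1 := by nlinarith
  have h4 : 4 * G * H * δ ^ 2 ≤ 1 := by
    calc 4 * G * H * δ ^ 2 = (4 * G * H * δ) * δ := by ring
      _ ≤ 1 * 1 := mul_le_mul h4' hδ1 hδ0.le zero_le_one
      _ = 1 := one_mul _
  -- `J`
  have hY0 : (0 : ℝ) < 4 * R₀ ^ 2 + 1 := by positivity
  obtain ⟨J, hJ⟩ : ∃ J : ℝ, J = (4 * R₀ ^ 2 + 1) ^ (1 + δ / 2) / (m * m * (6 * m) ^ δ) := ⟨_, rfl⟩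
  have h6m : 0 < (6 * m) ^ δ := Real.rpow_pos_of_pos (by positivity) δ
  have hJ0 : 0 < J := by rw [hJ]; exact div_pos (Real.rpow_pos_of_pos hY0 _) (by positivity)
  have hJeq : (4 * R₀ ^ 2 + 1) ^ (1 + δ / 2) ≤ J * m * m * (6 * m) ^ δ := by
    rw [hJ, mul_assoc, mul_assoc, ← mul_assoc m, div_mul_cancel₀ _ (by positivity : m * m * (6 * m) ^ δ ≠ 0)]
  -- `η`
  obtain ⟨c, hc⟩ : ∃ c : ℝ, c = 16 * 8 ^ δ * J := ⟨_, rfl⟩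
  have hc0 : 0 < c := by rw [hc]; exact mul_pos (mul_pos (by norm_num) (Real.rpow_pos_of_pos (by norm_num) _)) hJ0
  obtain ⟨η, hη⟩ : ∃ η : ℝ, η = min (1 / 2) (c ^ (-(1 / δ))) := ⟨_, rfl⟩
  have hη0 : 0 < η := by rw [hη]; exact lt_min (by norm_num) (Real.rpow_pos_of_pos hc0 _)
  have hη2 : η ≤ 1 / 2 := by rw [hη]; exact min_le_left _ _
  have hηc : η ≤ c ^ (-(1 / δ)) := by rw [hη]; exact min_le_right _ _
  have hηJ : 16 * 8 ^ δ * J * η ^ δ ≤ 1 := by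
    rw [← hc]
    have h1 : η ^ δ ≤ (c ^ (-(1 / δ))) ^ δ := Real.rpow_le_rpow hη0.le hηc hδ0.le
    have h2 : (c ^ (-(1 / δ))) ^ δ = c⁻¹ := by
      rw [← Real.rpow_mul hc0.le, show -(1 / δ) * δ = -1 by field_simp, Real.rpow_neg_one]
    rw [h2] at h1
    calc c * η ^ δ ≤ c * c⁻¹ := mul_le_mul_of_nonneg_left h1 hc0.le
      _ = 1 := mul_inv_cancel₀ hc0.ne'
  -- `ε`
  obtain ⟨ε, hε⟩ : ∃ ε : ℝ, ε = min (δ * η / 12) (η ^ 2 / 144) := ⟨_, rfl⟩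
  have hε0 : 0 < ε := by rw [hε]; exact lt_min (by positivity) (by positivity)
  have hε1 : 12 * ε ≤ δ * η := by
    have : ε ≤ δ * η / 12 := by rw [hε]; exact min_le_left _ _
    linarith
  have hε2 : 144 * ε ≤ η ^ 2 := by
    have : ε ≤ η ^ 2 / 144 := by rw [hε]; exact min_le_right _ _
    linarith
  have hεH : 192 * H * ε ≤ 1 := by
    have h1 : 12 * ε ≤ δ * (1 / 2) := hε1.trans (mul_le_mul_of_nonneg_left hη2 hδ0.le)
    have h2 : 8 * H * δ ≤ 1 := h8
    nlinarith [mul_pos hH0 hε0]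
  -- `K`
  obtain ⟨K, hK⟩ : ∃ K : ℝ, K = (4 * R₀ ^ 2 + 1) ^ (1 + ε / 2) / (m * m) := ⟨_, rfl⟩
  have hK0 : 0 < K := by rw [hK]; exact div_pos (Real.rpow_pos_of_pos hY0 _) (by positivity)
  have hKeq : (4 * R₀ ^ 2 + 1) ^ (1 + ε / 2) ≤ K * m * m := by
    rw [hK, mul_assoc, div_mul_cancel₀ _ (by positivity : m * m ≠ 0)]
  -- `θ`
  have h2ε : 0 < 2 + ε := by linarith
  obtain ⟨θ, hθ⟩ : ∃ θ : ℝ, θ = 2 * ε / (2 + ε) := ⟨_, rfl⟩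
  have hθε : θ * (2 + ε) = 2 * ε := by rw [hθ, div_mul_cancel₀ _ h2ε.ne']
  have hθ0 : 0 ≤ θ := by rw [hθ]; positivity
  have hθle : θ ≤ ε := by linarith [mul_nonneg hθ0 hε0.le]
  have hε1' : ε ≤ 1 := by
    have := mul_nonneg hε0.le (by linarith : (0 : ℝ) ≤ 192 * H - 1)
    linarith
  have hθ1 : θ ≤ 1 := hθle.trans hε1'
  have hθH : 6 * H * θ ≤ 1 := by
    have h1 : 6 * H * θ ≤ 6 * H * ε := mul_le_mul_of_nonneg_left hθle (by positivity)
    linarith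
  -- `L`
  have hm1 : 0 < m ^ (1 - θ) := Real.rpow_pos_of_pos hm _
  obtain ⟨L, hL⟩ : ∃ L : ℝ, L = 2 * K ^ (1 - θ / 2) + R₀ / m ^ (1 - θ) := ⟨_, rfl⟩
  have hKr : 0 ≤ 2 * K ^ (1 - θ / 2) := mul_nonneg zero_le_two (Real.rpow_nonneg hK0.le _)
  have hL1 : 2 * K ^ (1 - θ / 2) ≤ L := by rw [hL]; linarith [div_nonneg hR₀ hm1.le]
  have hL2 : R₀ ≤ L * m ^ (1 - θ) := by
    rw [hL, add_mul, div_mul_cancel₀ _ hm1.ne']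
    linarith [mul_nonneg hKr hm1.le]
  exact ⟨G, H, δ, J, η, ε, K, θ, L, ⟨hG0, hGH, hδ0, hδ1, h8, h4, hJ0, hη0, hη2, hηJ, hε0, hε1, hε2,
    hK0, hθε, hθ1, hθH, hL1⟩, hGm, hHm, hJeq, hKeq, hL2, hθ0⟩

/-- **A block triple in `{A, C symmetric} ∩ {tr A = tr C} ∩ {M ≥ m}` with entries bounded by `R₀`
lies in the pinching set** with any constants satisfying the six initial bounds of
`exists_pinching_constants` (`G, J, K, L ≥ 0`, `δ, ε > 0`, `θ ≤ 1`): the Ky Fan sums are at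
most `2R₀`, the Rayleigh quotients at most `R₀` and at least `m`, and `a - 2 tr (BT) + c ≥ 6m`.
[cite: Hamilton1986, §7, Thm. 7.1 (p. 170)] -/
theorem mem_pcoPinchingFive_of_bounds {m R₀ G H δ J K ε L θ : ℝ} (hm : 0 < m) (hG : 0 ≤ G)
    (hδ : 0 < δ) (hJ : 0 ≤ J) (hε : 0 < ε) (hK : 0 ≤ K) (hL : 0 ≤ L) (hθ1 : θ ≤ 1)
    (bG : 4 * R₀ ^ 2 ≤ G * m * m) (bH : R₀ ≤ H * m)
    (bJ : (4 * R₀ ^ 2 + 1) ^ (1 + δ / 2) ≤ J * m * m * (6 * m) ^ δ)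
    (bK : (4 * R₀ ^ 2 + 1) ^ (1 + ε / 2) ≤ K * m * m) (bL : R₀ ≤ L * m ^ (1 - θ))
    {p : Blocks} (hs : p.1.IsSymm ∧ p.2.2.IsSymm) (htr : p.1.trace = p.2.2.trace)
    (hop : OperatorGE p m)
    (hR₀ : (∑ k, ∑ l, |p.1 k l|) + (∑ k, ∑ l, |p.2.1 k l|) + ∑ k, ∑ l, |p.2.2 k l| ≤ R₀) :
    p ∈ pcoPinchingFive m G H J δ K ε L θ := by
  obtain ⟨A, B, C⟩ := p
  simp only at hs htr hR₀
  have hAnn : 0 ≤ ∑ k, ∑ l, |A k l| := Finset.sum_nonneg fun k _ ↦ Finset.sum_nonneg fun l _ ↦ abs_nonneg _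
  have hBnn : 0 ≤ ∑ k, ∑ l, |B k l| := Finset.sum_nonneg fun k _ ↦ Finset.sum_nonneg fun l _ ↦ abs_nonneg _
  have hCnn : 0 ≤ ∑ k, ∑ l, |C k l| := Finset.sum_nonneg fun k _ ↦ Finset.sum_nonneg fun l _ ↦ abs_nonneg _
  -- elementary bounds
  have hx : ∀ w : Fin 3 → ℝ, w ⬝ᵥ w = 1 → m ≤ w ⬝ᵥ (A *ᵥ w) := fun w hw ↦ by
    have := hop.quad_fst w; rw [hw, mul_one] at this; exact this
  have hxc : ∀ z : Fin 3 → ℝ, z ⬝ᵥ z = 1 → m ≤ z ⬝ᵥ (C *ᵥ z) := fun z hz ↦ by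
    have := hop.quad_snd_snd z; rw [hz, mul_one] at this; exact this
  have hAle : ∀ u : Fin 3 → ℝ, u ⬝ᵥ u = 1 → u ⬝ᵥ (A *ᵥ u) ≤ R₀ := fun u hu ↦ by
    have := (abs_le.1 (abs_quad_le_sum A hu)).2; linarith
  have hCle : ∀ u : Fin 3 → ℝ, u ⬝ᵥ u = 1 → u ⬝ᵥ (C *ᵥ u) ≤ R₀ := fun u hu ↦ by
    have := (abs_le.1 (abs_quad_le_sum C hu)).2; linarith
  have hY : ∀ u₁ u₂ v₁ v₂ : Fin 3 → ℝ, u₁ ⬝ᵥ u₁ = 1 → u₂ ⬝ᵥ u₂ = 1 → v₁ ⬝ᵥ v₁ = 1 → v₂ ⬝ᵥ v₂ = 1 →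
      (u₁ ⬝ᵥ (B *ᵥ v₁) + u₂ ⬝ᵥ (B *ᵥ v₂)) ^ 2 ≤ 4 * R₀ ^ 2 := by
    intro u₁ u₂ v₁ v₂ hu₁ hu₂ hv₁ hv₂
    have h1 := abs_le.1 ((abs_bilin_le_sum B hu₁ hv₁).trans (by linarith : ∑ k, ∑ l, |B k l| ≤ R₀))
    have h2 := abs_le.1 ((abs_bilin_le_sum B hu₂ hv₂).trans (by linarith : ∑ k, ∑ l, |B k l| ≤ R₀))
    nlinarith [h1.1, h1.2, h2.1, h2.2]
  have hprod : ∀ w z : Fin 3 → ℝ, w ⬝ᵥ w = 1 → z ⬝ᵥ z = 1 → m * m ≤ (w ⬝ᵥ (A *ᵥ w)) * (z ⬝ᵥ (C *ᵥ z)) :=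
    fun w z hw hz ↦ mul_le_mul (hx w hw) (hxc z hz) hm.le (by linarith [hx w hw])
  refine ⟨⟨⟨⟨hs, htr, hop, ?_, ?_, ?_⟩, ?_⟩, ?_⟩, ?_, ?_⟩
  · -- (1)
    intro u₁ u₂ v₁ v₂ w z hu₁ hu₂ _ hv₁ hv₂ _ hw hz
    have := mul_le_mul_of_nonneg_left (hprod w z hw hz) hG
    have := hY u₁ u₂ v₁ v₂ hu₁ hu₂ hv₁ hv₂
    simp only
    nlinarith
  · -- (2), block `A`
    intro u w hu hw
    have := hx w hw; have := hAle u hu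
    simp only
    rw [add_zero]
    nlinarith
  · -- (2), block `C`
    intro u w hu hw
    have := hxc w hw; have := hCle u hu
    simp only
    rw [add_zero]
    nlinarith
  · -- (3)
    intro u₁ u₂ v₁ v₂ w z T hu₁ hu₂ _ hv₁ hv₂ _ hw hz hT
    simp only
    have hW := traceW_ge_of_operatorGE hop hT
    simp only [traceW] at hW
    have h1 : ((u₁ ⬝ᵥ (B *ᵥ v₁) + u₂ ⬝ᵥ (B *ᵥ v₂)) ^ 2) ^ (1 + δ / 2) ≤ (4 * R₀ ^ 2 + 1) ^ (1 + δ / 2) :=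
      Real.rpow_le_rpow (sq_nonneg _) (by linarith [hY u₁ u₂ v₁ v₂ hu₁ hu₂ hv₁ hv₂]) (by linarith)
    have h2 : (6 * m) ^ δ ≤ (A.trace - 2 * (B * T).trace + C.trace) ^ δ :=
      Real.rpow_le_rpow (by positivity) hW hδ.le
    have h3 : J * m * m * (6 * m) ^ δ ≤ J * (w ⬝ᵥ (A *ᵥ w)) * (z ⬝ᵥ (C *ᵥ z)) *
        (A.trace - 2 * (B * T).trace + C.trace) ^ δ := by
      have := hprod w z hw hz
      have h6 : 0 ≤ (6 * m) ^ δ := Real.rpow_nonneg (by positivity) _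
      calc J * m * m * (6 * m) ^ δ = J * (m * m) * (6 * m) ^ δ := by ring
        _ ≤ J * ((w ⬝ᵥ (A *ᵥ w)) * (z ⬝ᵥ (C *ᵥ z))) * (A.trace - 2 * (B * T).trace + C.trace) ^ δ :=
            mul_le_mul (mul_le_mul_of_nonneg_left this hJ) h2 h6
              (mul_nonneg hJ (le_trans (mul_nonneg hm.le hm.le) this))
        _ = _ := by ring
    linarith
  · -- (4)
    intro u₁ u₂ v₁ v₂ w z hu₁ hu₂ _ hv₁ hv₂ _ hw hz
    simp only
    have h1 : ((u₁ ⬝ᵥ (B *ᵥ v₁) + u₂ ⬝ᵥ (B *ᵥ v₂)) ^ 2) ^ (1 + ε / 2) ≤ (4 * R₀ ^ 2 + 1) ^ (1 + ε / 2) :=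
      Real.rpow_le_rpow (sq_nonneg _) (by linarith [hY u₁ u₂ v₁ v₂ hu₁ hu₂ hv₁ hv₂]) (by linarith)
    have h3 : K * m * m ≤ K * (w ⬝ᵥ (A *ᵥ w)) * (z ⬝ᵥ (C *ᵥ z)) := by
      have := mul_le_mul_of_nonneg_left (hprod w z hw hz) hK
      linarith
    linarith
  · -- (5), block `A`
    intro u w hu hw
    simp only
    have h1 : m ^ (1 - θ) ≤ (w ⬝ᵥ (A *ᵥ w)) ^ (1 - θ) := Real.rpow_le_rpow hm.le (hx w hw) (by linarith)
    have h2 := mul_le_mul_of_nonneg_left h1 hL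
    linarith [hAle u hu, hx w hw]
  · -- (5), block `C`
    intro u w hu hw
    simp only
    have h1 : m ^ (1 - θ) ≤ (w ⬝ᵥ (C *ᵥ w)) ^ (1 - θ) := Real.rpow_le_rpow hm.le (hxc w hw) (by linarith)
    have h2 := mul_le_mul_of_nonneg_left h1 hL
    linarith [hCle u hu, hxc w hw]

/-- **The pinching estimate on `Z` in eigenvalue form** (Def. 5.1: `|M̊| ≤ C |M|^{1-δ}` on `Z`; here:
the spreads of the Rayleigh quotients of `A` and of `C` are at most `L a₁^{1-θ}`, resp.
`L c₁^{1-θ}`, every product `uᵀBv` satisfies `|uᵀBv|^{2+ε} ≤ K a₁ c₁` in the variational sense, and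
`tr A = tr C`). [cite: Hamilton1986, §5, Def. 5.1, 5.2 (pp. 163–164); §7, Thm. 7.1 (p. 170)] -/
theorem pcoPinchingFive_pinching {m G H J δ K ε L θ : ℝ} (hε : 0 < ε) {p : Blocks}
    (h : p ∈ pcoPinchingFive m G H J δ K ε L θ) :
    p.1.trace = p.2.2.trace ∧
      (∀ u w : Fin 3 → ℝ, u ⬝ᵥ u = 1 → w ⬝ᵥ w = 1 →
        u ⬝ᵥ (p.1 *ᵥ u) - w ⬝ᵥ (p.1 *ᵥ w) ≤ L * (w ⬝ᵥ (p.1 *ᵥ w)) ^ (1 - θ)) ∧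
      (∀ u w : Fin 3 → ℝ, u ⬝ᵥ u = 1 → w ⬝ᵥ w = 1 →
        u ⬝ᵥ (p.2.2 *ᵥ u) - w ⬝ᵥ (p.2.2 *ᵥ w) ≤ L * (w ⬝ᵥ (p.2.2 *ᵥ w)) ^ (1 - θ)) ∧
      (∀ u v w z : Fin 3 → ℝ, u ⬝ᵥ u = 1 → v ⬝ᵥ v = 1 → w ⬝ᵥ w = 1 → z ⬝ᵥ z = 1 →
        ((u ⬝ᵥ (p.2.1 *ᵥ v)) ^ 2) ^ (1 + ε / 2) ≤ K * (w ⬝ᵥ (p.1 *ᵥ w)) * (z ⬝ᵥ (p.2.2 *ᵥ z))) :=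
  ⟨h.1.1.1.2.1, fun u w hu hw ↦ by linarith [h.2.1 u w hu hw], fun u w hu hw ↦ by linarith [h.2.2 u w hu hw],
    fun _ _ _ _ hu hv hw hz ↦ h.1.2.rpow_sq_bilin_le hε hu hv hw hz⟩

end HamiltonODE

/-! ### Along the Ricci flow -/

open Lorentzian Lorentzian.PseudoRiemannianMetric HamiltonODE

section Compactness

variable {E : Type*} [NormedAddCommGroup E] [NormedSpace ℝ E] {H₀ : Type*} [TopologicalSpace H₀]
  {I : ModelWithCorners ℝ E H₀} {M : Type*} [TopologicalSpace M] [ChartedSpace H₀ M]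
  [IsManifold I ∞ M] [FiniteDimensional ℝ E] [CompleteSpace E] [T2Space M] [CompactSpace M]
  [LocallyCompactSpace M]
  {g : PseudoRiemannianMetric I ∞ E (TangentSpace I : M → Type _)}
  {cov : CovariantDerivative I E (TangentSpace I : M → Type _)}

/-- **The curvature blocks are uniformly bounded on a compact manifold**: for a Riemannian `C^∞`
metric with Levi-Civita connection on a compact manifold there is `R₀` with
`Σ|A| + Σ|B| + Σ|C| ≤ R₀` for the blocks of every orthonormal 4-frame at every point
(`exists_pos_le_curvatureFunctional` applied to `1/(1 + Σ|A| + Σ|B| + Σ|C|)`). [folklore] -/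
theorem exists_bound_blocks (hg : g.IsRiemannian) (hcov : g.IsLeviCivita cov) :
    ∃ R₀ : ℝ, 0 ≤ R₀ ∧ ∀ (x : M) (e : Fin 4 → TangentSpace I x), g.IsOrthonormalFrame x e →
      (∑ k, ∑ l, |g.blockA cov x e k l|) + (∑ k, ∑ l, |g.blockB cov x e k l|) +
        ∑ k, ∑ l, |g.blockC cov x e k l| ≤ R₀ := by
  -- index tables of Hamilton's bases, as in `exists_pos_operatorGE_blocks`
  set σ₁ : Fin 3 → Fin 2 → Fin 4 := ![![0, 2], ![0, 3], ![0, 1]] with hσ₁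
  set σ₂ : Fin 3 → Fin 2 → Fin 4 := ![![1, 3], ![2, 1], ![3, 2]] with hσ₂
  set τ₁ : Fin 3 → Fin 2 → Fin 4 := ![![0, 3], ![0, 1], ![0, 2]] with hτ₁
  set τ₂ : Fin 3 → Fin 2 → Fin 4 := ![![1, 2], ![2, 3], ![3, 1]] with hτ₂
  set MA : (Fin 4 → Fin 4 → Fin 4 → Fin 4 → ℝ) → Matrix (Fin 3) (Fin 3) ℝ := fun R ↦
    Matrix.of fun i j ↦ ∑ a, ∑ b, R (σ₁ i a) (σ₂ i a) (σ₂ j b) (σ₁ j b) with hMA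
  set MB : (Fin 4 → Fin 4 → Fin 4 → Fin 4 → ℝ) → Matrix (Fin 3) (Fin 3) ℝ := fun R ↦
    Matrix.of fun i j ↦ ∑ a, ∑ b, R (σ₁ i a) (σ₂ i a) (τ₂ j b) (τ₁ j b) with hMB
  set MC : (Fin 4 → Fin 4 → Fin 4 → Fin 4 → ℝ) → Matrix (Fin 3) (Fin 3) ℝ := fun R ↦
    Matrix.of fun i j ↦ ∑ a, ∑ b, R (τ₁ i a) (τ₂ i a) (τ₂ j b) (τ₁ j b) with hMC
  have hA : ∀ (x : M) (e : Fin 4 → TangentSpace I x),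
      MA (fun a b c d ↦ g.curvatureForm cov x (e a) (e b) (e c) (e d)) = g.blockA cov x e := by
    intro x e
    ext i j
    fin_cases i <;> fin_cases j <;>
      simp [hMA, hσ₁, hσ₂, blockA, pairingCurvature, bivectorCurvature, selfDualPairs,
        Fin.sum_univ_two]
  have hB : ∀ (x : M) (e : Fin 4 → TangentSpace I x),
      MB (fun a b c d ↦ g.curvatureForm cov x (e a) (e b) (e c) (e d)) = g.blockB cov x e := by
    intro x e
    ext i j
    fin_cases i <;> fin_cases j <;>
      simp [hMB, hσ₁, hσ₂, hτ₁, hτ₂, blockB, pairingCurvature, bivectorCurvature, selfDualPairs,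
        antiSelfDualPairs, Fin.sum_univ_two]
  have hC : ∀ (x : M) (e : Fin 4 → TangentSpace I x),
      MC (fun a b c d ↦ g.curvatureForm cov x (e a) (e b) (e c) (e d)) = g.blockC cov x e := by
    intro x e
    ext i j
    fin_cases i <;> fin_cases j <;>
      simp [hMC, hτ₁, hτ₂, blockC, pairingCurvature, bivectorCurvature, antiSelfDualPairs,
        Fin.sum_univ_two]
  -- the functional `1 / (1 + Σ|A| + Σ|B| + Σ|C|)`
  set S : (Fin 4 → Fin 4 → Fin 4 → Fin 4 → ℝ) → ℝ := fun R ↦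
    (∑ k, ∑ l, |MA R k l|) + (∑ k, ∑ l, |MB R k l|) + ∑ k, ∑ l, |MC R k l| with hS
  set F : (Fin 4 → Fin 4 → Fin 4 → Fin 4 → ℝ) → ℝ → ℝ := fun R _ ↦ 1 / (1 + S R) with hF
  have hRcont : ∀ a b c d : Fin 4,
      Continuous fun R : Fin 4 → Fin 4 → Fin 4 → Fin 4 → ℝ ↦ R a b c d := fun a b c d ↦
    (continuous_apply d).comp ((continuous_apply c).comp
      ((continuous_apply b).comp (continuous_apply a)))
  have hMcont : ∀ {ρ₁ ρ₂ ρ₃ ρ₄ : Fin 3 → Fin 2 → Fin 4},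
      Continuous fun R : Fin 4 → Fin 4 → Fin 4 → Fin 4 → ℝ ↦
        (Matrix.of fun i j ↦ ∑ a, ∑ b, R (ρ₁ i a) (ρ₂ i a) (ρ₃ j b) (ρ₄ j b) :
          Matrix (Fin 3) (Fin 3) ℝ) := by
    intro ρ₁ ρ₂ ρ₃ ρ₄
    refine continuous_matrix fun i j ↦ ?_
    simp only [Matrix.of_apply]
    exact continuous_finsetSum _ fun a _ ↦ continuous_finsetSum _ fun b _ ↦ hRcont _ _ _ _
  have hent : ∀ {f : (Fin 4 → Fin 4 → Fin 4 → Fin 4 → ℝ) → Matrix (Fin 3) (Fin 3) ℝ}, Continuous f →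
      Continuous fun R ↦ ∑ k, ∑ l, |f R k l| := by
    intro f hf
    exact continuous_finsetSum _ fun k _ ↦ continuous_finsetSum _ fun l _ ↦
      (hf.matrix_elem k l).abs
  have hSnn : ∀ R, 0 ≤ S R := fun R ↦ by
    simp only [hS]
    exact add_nonneg (add_nonneg (Finset.sum_nonneg fun k _ ↦ Finset.sum_nonneg fun l _ ↦ abs_nonneg _)
      (Finset.sum_nonneg fun k _ ↦ Finset.sum_nonneg fun l _ ↦ abs_nonneg _))
      (Finset.sum_nonneg fun k _ ↦ Finset.sum_nonneg fun l _ ↦ abs_nonneg _)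
  have hScont : Continuous S := ((hent hMcont).add (hent hMcont)).add (hent hMcont)
  have hFcont : ContinuousOn (uncurry F) (univ ×ˢ ({0} : Set ℝ)) := by
    refine Continuous.continuousOn ?_
    have h1 : Continuous fun q : (Fin 4 → Fin 4 → Fin 4 → Fin 4 → ℝ) × ℝ ↦ 1 + S q.1 :=
      continuous_const.add (hScont.comp continuous_fst)
    exact continuous_const.div h1 fun q ↦ ne_of_gt (by have := hSnn q.1; linarith)
  have hpos : ∀ (x : M) (e : Fin 4 → TangentSpace I x), g.IsOrthonormalFrame x e →
      ∀ y ∈ ({0} : Set ℝ), 0 < F (fun a b c d ↦ g.curvatureForm cov x (e a) (e b) (e c) (e d)) y := by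
    intro x e _ y _
    simp only [hF]
    exact div_pos one_pos (by linarith [hSnn (fun a b c d ↦ g.curvatureForm cov x (e a) (e b) (e c) (e d))])
  obtain ⟨m₀, hm₀, hle⟩ := exists_pos_le_curvatureFunctional hg hcov isCompact_singleton hFcont hpos
  refine ⟨1 / m₀, by positivity, fun x e he ↦ ?_⟩
  have h := hle x e he 0 rfl
  simp only [hF] at h
  have hS1 : 0 < 1 + S (fun a b c d ↦ g.curvatureForm cov x (e a) (e b) (e c) (e d)) := by
    linarith [hSnn (fun a b c d ↦ g.curvatureForm cov x (e a) (e b) (e c) (e d))]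
  rw [le_div_iff₀ hS1] at h
  have h2 : S (fun a b c d ↦ g.curvatureForm cov x (e a) (e b) (e c) (e d)) ≤ 1 / m₀ := by
    rw [le_div_iff₀ hm₀]; nlinarith
  simpa only [hS, hA x e, hB x e, hC x e] using h2

end Compactness

universe u

/-- **The pinching set is preserved along the Ricci flow, given the maximum principle for systems**
(Hamilton 1986, 5.2, p. 164: "at time `t = 0` the curvature operator `M` lies in `X = P ×_G Z`.
Then it will remain in `X` by the argument in §4"): for admissible constants (the eighteen
hypotheses of `isInvariant_pcoPinchingFive`), if along a Ricci flow of Riemannian metrics on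
`[0, T)` on a closed smooth 4-manifold the blocks of `g(0)` lie in `Z = pcoPinchingFive m G H J δ K ε L θ`
at every point in every orthonormal frame, then so do the blocks of `g(t)` for all `t ∈ [0, T)` —
the named fact `hamilton_maximumPrinciple_curvatureODE` applied to `Z`, which is closed, convex,
`B ↦ -B`-symmetric and forward invariant. [cite: Hamilton1986, §5, 5.2 (p. 164); §4, Thm. 4.3 (p. 162); §7, Thm. 7.1 (p. 170)] -/
theorem ricciFlow_mem_pcoPinchingFive_of_maximumPrinciple
    (hMP : hamilton_maximumPrinciple_curvatureODE.{u})
    (M : Type u) [TopologicalSpace M] [T2Space M] [SecondCountableTopology M] [CompactSpace M]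
    [ChartedSpace (EuclideanSpace ℝ (Fin 4)) M] [IsManifold (𝓡 4) ∞ M] (T : ℝ)
    (g : ℝ → PseudoRiemannianMetric (𝓡 4) ∞ (EuclideanSpace ℝ (Fin 4))
      (TangentSpace (𝓡 4) : M → Type _))
    (cov : ℝ → CovariantDerivative (𝓡 4) (EuclideanSpace ℝ (Fin 4))
      (TangentSpace (𝓡 4) : M → Type _))
    (hflow : IsRicciFlow g cov (Ico 0 T)) (hRiem : ∀ t ∈ Ico 0 T, (g t).IsRiemannian)
    {m G H J δ η K ε θ L : ℝ} (hm : 0 < m) (hG : 0 < G) (hH : G + 1 ≤ H)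
    (hJ : 0 < J) (hδ : 0 < δ) (hδ1 : δ ≤ 1) (hδH : 8 * H * δ ≤ 1) (hδGH : 4 * G * H * δ ^ 2 ≤ 1)
    (hη : 0 < η) (hη2 : η ≤ 1 / 2) (hηJ : 16 * 8 ^ δ * J * η ^ δ ≤ 1) (hK : 0 < K)
    (hε : 0 < ε) (hε1 : 12 * ε ≤ δ * η) (hε2 : 144 * ε ≤ η ^ 2)
    (hθε : θ * (2 + ε) = 2 * ε) (hθ1 : θ ≤ 1) (hθH : 6 * H * θ ≤ 1) (hL : 2 * K ^ (1 - θ / 2) ≤ L)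
    (h0 : ∀ (x : M) (e : Fin 4 → TangentSpace (𝓡 4) x), (g 0).IsOrthonormalFrame x e →
      ((g 0).blockA (cov 0) x e, (g 0).blockB (cov 0) x e, (g 0).blockC (cov 0) x e) ∈
        pcoPinchingFive m G H J δ K ε L θ) :
    ∀ t ∈ Ico 0 T, ∀ (x : M) (e : Fin 4 → TangentSpace (𝓡 4) x), (g t).IsOrthonormalFrame x e →
      ((g t).blockA (cov t) x e, (g t).blockB (cov t) x e, (g t).blockC (cov t) x e) ∈
        pcoPinchingFive m G H J δ K ε L θ := by
  have hθ0 : 0 ≤ θ := by nlinarith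
  have hL0 : 0 ≤ L := le_trans (mul_nonneg zero_le_two (Real.rpow_nonneg hK.le _)) hL
  have hcl : IsClosed (pcoPinchingFive m G H J δ K ε L θ) := isClosed_pcoPinchingFive m G H J K L hδ.le hε.le hθ1
  exact hMP M T g cov hflow hRiem (fun _ ↦ pcoPinchingFive m G H J δ K ε L θ) (fun _ ↦ hcl)
    (fun _ ↦ convex_pcoPinchingFive hm.le hG.le hJ.le hδ hK.le hε hL0 hθ0 hθ1 H)
    (isClosed_Ici.prod hcl) (fun _ p hp ↦ reflectB_mem_pcoPinchingFive hp)
    (isInvariant_pcoPinchingFive hm hG hH hJ hδ hδ1 hδH hδGH hη hη2 hηJ hK hε hε1 hε2 hθε hθ1 hθH hL) h0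

/-- **Hamilton 1986, Thm. 7.1 with §4 along the Ricci flow: an initial metric of positive curvature
operator evolves inside a pinching set.** Along a Ricci flow `(g, cov)` of Riemannian metrics on
`[0, T)` on a closed smooth 4-manifold whose initial pair has positive curvature operator
(`HasPositiveCurvatureOperatorWith`), given the maximum principle for systems (the named fact
`hamilton_maximumPrinciple_curvatureODE`), there are `m > 0` and admissible constants such that for
every `t ∈ [0, T)` the blocks of `(g t, cov t)` lie in `Z = pcoPinchingFive m G H J δ K ε L θ` in
every orthonormal frame (so the pinching estimate `pcoPinchingFive_pinching` holds along the flow —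
the hypothesis of the convergence criterion 5.2). Compactness at `t = 0`
(`exists_pos_operatorGE_blocks`, `exists_bound_blocks`), the choice of constants
(`exists_pinching_constants`, `mem_pcoPinchingFive_of_bounds`), and
`ricciFlow_mem_pcoPinchingFive_of_maximumPrinciple`.
[cite: Hamilton1986, §7, Thm. 7.1 (p. 170); §5, 5.2 (p. 164); §4, Thm. 4.3 (p. 162)] -/
theorem ricciFlow_pinchingSet_of_hasPositiveCurvatureOperatorWith
    (hMP : hamilton_maximumPrinciple_curvatureODE.{u})
    (M : Type u) [TopologicalSpace M] [T2Space M] [SecondCountableTopology M] [CompactSpace M]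
    [ChartedSpace (EuclideanSpace ℝ (Fin 4)) M] [IsManifold (𝓡 4) ∞ M] (T : ℝ)
    (g : ℝ → PseudoRiemannianMetric (𝓡 4) ∞ (EuclideanSpace ℝ (Fin 4))
      (TangentSpace (𝓡 4) : M → Type _))
    (cov : ℝ → CovariantDerivative (𝓡 4) (EuclideanSpace ℝ (Fin 4))
      (TangentSpace (𝓡 4) : M → Type _))
    (hflow : IsRicciFlow g cov (Ico 0 T)) (hRiem : ∀ t ∈ Ico 0 T, (g t).IsRiemannian)
    (hR : (g 0).HasPositiveCurvatureOperatorWith (cov 0)) (hT : 0 < T) :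
    ∃ m G H J δ η K ε θ L : ℝ, 0 < m ∧
      (0 < G ∧ G + 1 ≤ H ∧ 0 < δ ∧ δ ≤ 1 ∧ 8 * H * δ ≤ 1 ∧ 4 * G * H * δ ^ 2 ≤ 1 ∧ 0 < J ∧
        0 < η ∧ η ≤ 1 / 2 ∧ 16 * 8 ^ δ * J * η ^ δ ≤ 1 ∧ 0 < ε ∧ 12 * ε ≤ δ * η ∧ 144 * ε ≤ η ^ 2 ∧
        0 < K ∧ θ * (2 + ε) = 2 * ε ∧ θ ≤ 1 ∧ 6 * H * θ ≤ 1 ∧ 2 * K ^ (1 - θ / 2) ≤ L) ∧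
      ∀ t ∈ Ico 0 T, ∀ (x : M) (e : Fin 4 → TangentSpace (𝓡 4) x), (g t).IsOrthonormalFrame x e →
        ((g t).blockA (cov t) x e, (g t).blockB (cov t) x e, (g t).blockC (cov t) x e) ∈
          pcoPinchingFive m G H J δ K ε L θ := by
  haveI : LocallyCompactSpace M := ChartedSpace.locallyCompactSpace (EuclideanSpace ℝ (Fin 4)) M
  have hn : (2 : ℕ∞ω) ≤ ∞ := WithTop.coe_le_coe.mpr le_top
  have hLC : (g 0).IsLeviCivita (cov 0) := hflow.isLeviCivita 0 ⟨le_rfl, hT⟩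
  have hg0 : (g 0).IsRiemannian := hRiem 0 ⟨le_rfl, hT⟩
  obtain ⟨m, hm, hop⟩ := hR.exists_pos_operatorGE_blocks hg0 hLC
  obtain ⟨R₀, hR₀, hbd⟩ := exists_bound_blocks hg0 hLC
  obtain ⟨G, H, δ, J, η, ε, K, θ, L, hadm, bG, bH, bJ, bK, bL, -⟩ := exists_pinching_constants hm hR₀
  obtain ⟨hG, hGH, hδ, hδ1, hδH, hδGH, hJ, hη, hη2, hηJ, hε, hε1, hε2, hK, hθε, hθ1, hθH, hL⟩ := hadm
  have hL0 : 0 ≤ L := le_trans (mul_nonneg zero_le_two (Real.rpow_nonneg hK.le _)) hL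
  refine ⟨m, G, H, J, δ, η, K, ε, θ, L, hm, ⟨hG, hGH, hδ, hδ1, hδH, hδGH, hJ, hη, hη2, hηJ, hε, hε1, hε2,
    hK, hθε, hθ1, hθH, hL⟩, ?_⟩
  refine ricciFlow_mem_pcoPinchingFive_of_maximumPrinciple hMP M T g cov hflow hRiem hm hG hGH hJ hδ hδ1
    hδH hδGH hη hη2 hηJ hK hε hε1 hε2 hθε hθ1 hθH hL fun x e he ↦ ?_
  exact mem_pcoPinchingFive_of_bounds hm hG.le hδ hJ.le hε hK.le hL0 hθ1 bG bH bJ bK bL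
    ⟨blockA_isSymm hLC hn x e, blockC_isSymm hLC hn x e⟩ (trace_blockA_eq_trace_blockC hLC hn x e)
    (hop x e he) (hbd x e he)

end Literature.Geometry.Riemannian

end
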